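import Summits.CriticalPhenomena.PercolationContinuityZ3.Theorems.SahiMasterFamilyCommonPivotal
import Summits.CriticalPhenomena.PercolationContinuityZ3.Theorems.SahiMasterFamilySupport

/-!
# `E_k` along one coordinate: the polynomial in `p_e`, its top coefficient, (T-a) at every order, and the
# `(k−1)`-shared coordinate detector

Unit `prim-master-conj` (crux anchor stmt-CriticalPhenomena-4575), gen 7.  For a family `F` of `k` real functions on configurations and a
product measure `μ_p`, the function `s ↦ E_k(μ_{p[e ↦ s]}; F)` is a polynomial of degree `≤ k` in `s` (every moment is affine in `s`,
`ex_update_eq`).  We build it once and for all as a `Polynomial ℝ` by running the Lieb–Sahi recursion with polynomial-valued moments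
(`sahiEP`, any "moment map" of degree `≤ 1`), prove `eval = sahiE` (`eval_sahiEP`), `natDegree ≤ k` and the **top coefficient**
`[s^k] = (−1)^{k−1} ∏_j (X₁ − X₀)(F_j)` (`coeff_sahiEP_top`; `X_b` = section moments off `e`).  Consequences:
* **(T-a) at every order** (`sahiENonvanishing_of_common_pivotal_all`): `k ≥ 1` increasing events with a COMMON pivotal coordinate have
  `E_k(μ_p) ≠ 0` somewhere in the open cube (indeed on every fibre `p[e ↦ ·]`): the top coefficient is `± ∏_j I_e(U_j) ≠ 0`, and a non-zero
  polynomial has finitely many roots.  (Order 3 = the tree's `sahiE3Nonvanishing_of_common_pivotal`.)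
* **the `(k−1)`-shared detector** (`detector_of_forall_sahiE_update_eq_zero`): if `U_{i₀}` does not depend on `e` and `E_k ≡ 0` on a fibre,
  then, peeling at the slot `i₀` (`sahiE_peel`), the `s^{k−1}`-coefficient gives the identity
  `Σ_{j ≠ i₀} XΔ(1_{U_j}·1_{U_{i₀}}) ∏_{l ∉ {j,i₀}} XΔ(1_{U_l}) = X₀(1_{U_{i₀}}) ∏_{j ≠ i₀} XΔ(1_{U_j})`  (`XΔ := X₁ − X₀`), i.e.
  `Σ_j P(U_{i₀} ∩ Piv_e U_j) ∏_{l ≠ j} P(Piv_e U_l) = P(U_{i₀}) ∏_j P(Piv_e U_j)` off `e` — the coefficient whose RIGIDITY (prim-masterthm-p4's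
  R₃, proved; R₄, conjectured) drives the classification-free route to (T_k).
Together with private gluing (`SahiMasterFamilyPrivateGluing`: no private coordinate) this pins every coordinate of a terminal family of
the (EQI-k) minors induction to `2 ≤ r_e ≤ k − 1` members, at every order.  Axioms standard. [this work]
-/

noncomputable section

open scoped Classical

namespace Summit.CriticalPhenomena.PercolationContinuityZ3.Theorems

open Finset Function Polynomial
open Literature.Combinatorics.Sahi2008
open Literature.Probability.LatticeModels.Kahn2022 (Affects)
open Literature.Probability.Percolation.DecisionTree (ind ind_of_mem ind_of_not_mem ind_nonneg)

/-! ### The Lieb–Sahi recursion with polynomial moments -/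

section Abstract

variable {α : Type*} (M : (α → ℝ) → ℝ[X])

/-- **Sahi's functional with polynomial-valued moments**: the Lieb–Sahi recursion (`sahiE`) run with a "moment map" `M : (α → ℝ) → ℝ[X]`
in place of `ex μ`. [this work] -/
def sahiEP : (n : ℕ) → (Fin n → α → ℝ) → ℝ[X]
  | 0, _ => 0
  | 1, f => M (f 0)
  | n + 2, f =>
      (∑ i : Fin (n + 1), sahiEP (n + 1) (update (Fin.tail f) i (Fin.tail f i * f 0))) - sahiEP (n + 1) (Fin.tail f) * M (f 0)

/-- **Evaluation**: if `M h` evaluates at `s` to `ex μ h` for every `h`, then `sahiEP M n F` evaluates at `s` to `sahiE μ n F`. [this work] -/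
theorem eval_sahiEP [Fintype α] (μ : α → ℝ) (s : ℝ) (hM : ∀ h, (M h).eval s = ex μ h) :
    ∀ (n : ℕ) (F : Fin n → α → ℝ), (sahiEP M n F).eval s = sahiE μ n F
  | 0, F => by rw [sahiEP, sahiE_zero, eval_zero]
  | 1, F => by rw [sahiEP, sahiE_one_apply, hM]
  | n + 2, F => by
    rw [sahiEP, sahiE_succ_succ, eval_sub, eval_mul, eval_finsetSum, hM, eval_sahiEP μ s hM (n + 1)]
    congr 1
    exact sum_congr rfl fun i _ => eval_sahiEP μ s hM (n + 1) _

/-- **Degree bound**: with moments of degree `≤ 1`, `sahiEP M n F` has degree `≤ n`. [this work] -/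
theorem natDegree_sahiEP_le (hM : ∀ h, (M h).natDegree ≤ 1) : ∀ (n : ℕ) (F : Fin n → α → ℝ), (sahiEP M n F).natDegree ≤ n
  | 0, F => by simp [sahiEP]
  | 1, F => by rw [sahiEP]; exact hM _
  | n + 2, F => by
    rw [sahiEP]
    refine (natDegree_sub_le _ _).trans (max_le ?_ ?_)
    · exact (Polynomial.natDegree_sum_le_of_forall_le _ _ fun i _ => natDegree_sahiEP_le hM (n + 1) _).trans (by omega)
    · exact natDegree_mul_le.trans ((add_le_add (natDegree_sahiEP_le hM (n + 1) _) (hM _)).trans (by omega))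

/-- **Top coefficient**: with moments of degree `≤ 1`, `[X^{n+1}] sahiEP M (n+1) F = (−1)^n ∏_j [X] M (F j)` — only the all-singleton
partition reaches the top degree. [this work] -/
theorem coeff_sahiEP_top (hM : ∀ h, (M h).natDegree ≤ 1) :
    ∀ (n : ℕ) (F : Fin (n + 1) → α → ℝ), (sahiEP M (n + 1) F).coeff (n + 1) = (-1) ^ n * ∏ j, (M (F j)).coeff 1
  | 0, F => by rw [sahiEP, Fin.prod_univ_one, pow_zero, one_mul]
  | n + 1, F => by
    rw [sahiEP, coeff_sub, finsetSum_coeff]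
    have h1 : ∀ i : Fin (n + 1), (sahiEP M (n + 1) (update (Fin.tail F) i (Fin.tail F i * F 0))).coeff (n + 1 + 1) = 0 := fun i =>
      coeff_eq_zero_of_natDegree_lt ((natDegree_sahiEP_le M hM (n + 1) _).trans_lt (by omega))
    rw [sum_eq_zero fun i _ => h1 i, zero_sub, coeff_mul_add_eq_of_natDegree_le (natDegree_sahiEP_le M hM (n + 1) _) (hM _),
      coeff_sahiEP_top hM n (Fin.tail F)]
    conv_rhs => rw [Fin.prod_univ_succ]
    simp only [Fin.tail, pow_succ]
    ring

end Abstract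

/-! ### One coordinate of a product measure -/

section Bernoulli

variable {ι : Type*} [Fintype ι]

/-- **The affine moment map of the coordinate `e`** at `p`: `h ↦ X₀(h) + (X₁(h) − X₀(h))·s`, section moments off `e`. [this work] -/
def secPoly (p : ι → unitInterval) (e : ι) (h : Set ι → ℝ) : ℝ[X] :=
  C (secEx p e h false) + C (secEx p e h true - secEx p e h false) * Polynomial.X

/-- The moment map has degree `≤ 1`. [this work] -/
theorem natDegree_secPoly_le (p : ι → unitInterval) (e : ι) (h : Set ι → ℝ) : (secPoly p e h).natDegree ≤ 1 := by
  rw [secPoly, add_comm]; exact natDegree_linear_le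

/-- Its `s`-coefficient is `X₁ − X₀`. [this work] -/
theorem coeff_secPoly_one (p : ι → unitInterval) (e : ι) (h : Set ι → ℝ) :
    (secPoly p e h).coeff 1 = secEx p e h true - secEx p e h false := by
  simp [secPoly, coeff_C]

/-- Its constant coefficient is `X₀`. [this work] -/
theorem coeff_secPoly_zero (p : ι → unitInterval) (e : ι) (h : Set ι → ℝ) : (secPoly p e h).coeff 0 = secEx p e h false := by
  simp [secPoly, coeff_C]

/-- It evaluates at `s ∈ [0,1]` to the moment under `μ_{p[e ↦ s]}` (`ex_update_eq`). [this work] -/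
theorem eval_secPoly (p : ι → unitInterval) (e : ι) (s : unitInterval) (h : Set ι → ℝ) :
    (secPoly p e h).eval (s : ℝ) = ex (bernoulliWeight (update p e s)) h := by
  rw [ex_update_eq, secPoly, eval_add, eval_mul, eval_C, eval_C, eval_X]
  ring

/-- **`E_n` along the coordinate `e` is the polynomial `sahiEP (secPoly p e) n F`.** [this work] -/
theorem sahiE_update_eq_eval (p : ι → unitInterval) (e : ι) (s : unitInterval) (n : ℕ) (F : Fin n → Set ι → ℝ) :
    sahiE (bernoulliWeight (update p e s)) n F = (sahiEP (secPoly p e) n F).eval (s : ℝ) :=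
  (eval_sahiEP (secPoly p e) _ _ (fun h => eval_secPoly p e s h) n F).symm

/-- **Vanishing on the open fibre kills the polynomial**: if `E_n(μ_{p[e↦s]}; F) = 0` for every `s ∈ (0,1)` then `sahiEP (secPoly p e) n F = 0`.
[this work] -/
theorem sahiEP_eq_zero_of_forall (p : ι → unitInterval) (e : ι) (n : ℕ) (F : Fin n → Set ι → ℝ)
    (h : ∀ s : unitInterval, (s : ℝ) ∈ Set.Ioo (0 : ℝ) 1 → sahiE (bernoulliWeight (update p e s)) n F = 0) :
    sahiEP (secPoly p e) n F = 0 := by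
  refine Polynomial.eq_zero_of_infinite_isRoot _ ((Set.Ioo_infinite (zero_lt_one' ℝ)).mono fun x hx => ?_)
  rw [Set.mem_setOf_eq, IsRoot.def, ← h ⟨x, hx.1.le, hx.2.le⟩ hx, sahiE_update_eq_eval]

/-- A section moment of a function not depending on `e`: `X₁(1_A) = X₀(1_A)` when `e` does not act on the increasing event `A`. [this work] -/
theorem secEx_ind_true_eq_false {A : Set (Set ι)} (hA : IsUpperSet A) {e : ι} (he : ¬ Affects A e) (p : ι → unitInterval) :
    secEx p e (ind A) true = secEx p e (ind A) false := by
  simp only [secEx, Bool.false_eq_true, if_false, if_true]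
  refine sum_congr rfl fun ω _ => ?_
  congr 1
  by_cases hω : ω ∈ A
  · rw [ind_of_mem hω, ind_of_mem ((insert_mem_iff_of_not_affects hA he ω).2 hω)]
  · rw [ind_of_not_mem hω, ind_of_not_mem (fun h => hω ((insert_mem_iff_of_not_affects hA he ω).1 h))]

omit [Fintype ι] in
/-- Moving one coordinate of an interior parameter vector inside `(0,1)` keeps it interior. [folklore] -/
theorem update_mem_Ioo {p : ι → unitInterval} (hp : ∀ i, (p i : ℝ) ∈ Set.Ioo (0 : ℝ) 1) (e : ι) {s : unitInterval}
    (hs : (s : ℝ) ∈ Set.Ioo (0 : ℝ) 1) (i : ι) : (update p e s i : ℝ) ∈ Set.Ioo (0 : ℝ) 1 := by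
  by_cases hi : i = e
  · subst hi; rw [update_self]; exact hs
  · rw [update_of_ne hi]; exact hp i

/-! ### (T-a) at every order -/

/-- **A common pivotal coordinate makes `E_k` non-zero on every fibre**: for `k = n+1 ≥ 1` increasing events each having `e` pivotal, and any
interior `p`, some `s ∈ (0,1)` has `E_k(μ_{p[e↦s]}; 1_U) ≠ 0` — the `s^k`-coefficient is `(−1)^{k−1} ∏_j I_e(U_j) ≠ 0`. [this work] -/
theorem exists_sahiE_update_ne_zero_of_common_pivotal {p : ι → unitInterval} (hp : ∀ i, (p i : ℝ) ∈ Set.Ioo (0 : ℝ) 1) (e : ι)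
    {n : ℕ} (U : Fin (n + 1) → Set (Set ι)) (hU : ∀ j, IsUpperSet (U j))
    (he : ∀ j, ∃ ω, e ∉ ω ∧ ω ∉ U j ∧ insert e ω ∈ U j) :
    ∃ s : unitInterval, (s : ℝ) ∈ Set.Ioo (0 : ℝ) 1 ∧ sahiE (bernoulliWeight (update p e s)) (n + 1) (fun j => ind (U j)) ≠ 0 := by
  by_contra hall
  push Not at hall
  have h0 := sahiEP_eq_zero_of_forall p e (n + 1) _ hall
  have hc := coeff_sahiEP_top (secPoly p e) (natDegree_secPoly_le p e) n (fun j => ind (U j))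
  rw [h0, coeff_zero] at hc
  have hpos : 0 < ∏ j, (secPoly p e (ind (U j))).coeff 1 :=
    prod_pos fun j _ => by rw [coeff_secPoly_one]; exact secEx_ind_sub_pos hp e (hU j) (he j)
  exact (mul_ne_zero (pow_ne_zero _ (by norm_num)) hpos.ne') hc.symm

/-- **(T-a) at every order**: `k ≥ 1` increasing events on a finite `ι` with a common pivotal coordinate have `E_k(μ_p; 1_U) ≠ 0` for some
interior `p` (so they are never in the zero-flag class, consistently with `MasterFamilyIdentEqIff`). [this work] -/
theorem sahiENonvanishing_of_common_pivotal_all {ι : Type} [Fintype ι] {n : ℕ} (U : Fin (n + 1) → Set (Set ι))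
    (hU : ∀ j, IsUpperSet (U j)) (e : ι) (he : ∀ j, ∃ ω, e ∉ ω ∧ ω ∉ U j ∧ insert e ω ∈ U j) :
    ∃ p : ι → unitInterval, (∀ i, (p i : ℝ) ∈ Set.Ioo (0 : ℝ) 1) ∧ sahiE (bernoulliWeight p) (n + 1) (fun j => ind (U j)) ≠ 0 := by
  obtain ⟨s, hs, hne⟩ := exists_sahiE_update_ne_zero_of_common_pivotal (halfParams_mem_Ioo ι) e U hU he
  exact ⟨update (halfParams ι) e s, update_mem_Ioo (halfParams_mem_Ioo ι) e hs, hne⟩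

/-! ### The `(k−1)`-shared coordinate detector -/

/-- **The detector identity** (the `s^{k−1}`-coefficient after peeling at an `e`-free slot).  Let `F : Fin (n+2) → (Set ι → ℝ)`, `i₀` a slot
with `X₁(F i₀) = X₀(F i₀)` (e.g. the indicator of an increasing event not depending on `e`), and suppose `E_{n+2}(μ_{p[e↦s]}; F) = 0` for all
`s ∈ (0,1)`.  Then, with `G := F` off `i₀` and `XΔ := X₁ − X₀`,
`Σ_l XΔ(G_l · F_{i₀}) · ∏_{j ≠ l} XΔ(G_j) = X₀(F_{i₀}) · ∏_j XΔ(G_j)`. [this work] -/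
theorem detector_of_forall_sahiE_update_eq_zero (p : ι → unitInterval) (e : ι) {n : ℕ} (F : Fin (n + 2) → Set ι → ℝ) (i₀ : Fin (n + 2))
    (hfree : secEx p e (F i₀) true = secEx p e (F i₀) false)
    (h : ∀ s : unitInterval, (s : ℝ) ∈ Set.Ioo (0 : ℝ) 1 → sahiE (bernoulliWeight (update p e s)) (n + 2) F = 0) :
    (∑ l : Fin (n + 1), (secEx p e (F (i₀.succAbove l) * F i₀) true - secEx p e (F (i₀.succAbove l) * F i₀) false) *
        ∏ j ∈ univ.erase l, (secEx p e (F (i₀.succAbove j)) true - secEx p e (F (i₀.succAbove j)) false)) =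
      secEx p e (F i₀) false * ∏ j, (secEx p e (F (i₀.succAbove j)) true - secEx p e (F (i₀.succAbove j)) false) := by
  have hM : ∀ h, (secPoly p e h).natDegree ≤ 1 := natDegree_secPoly_le p e
  set G : Fin (n + 1) → Set ι → ℝ := fun j => F (i₀.succAbove j) with hG
  -- the peeled polynomial
  set Q : ℝ[X] := (∑ l : Fin (n + 1), sahiEP (secPoly p e) (n + 1) (update G l (G l * F i₀))) -
    sahiEP (secPoly p e) (n + 1) G * secPoly p e (F i₀) with hQ
  -- `Q` evaluates to `E_{n+2}` on the fibre (peel at `i₀`), hence vanishes on `(0,1)`, hence is zero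
  have hQeval : ∀ s : unitInterval, Q.eval (s : ℝ) = sahiE (bernoulliWeight (update p e s)) (n + 2) F := by
    intro s
    rw [sahiE_peel _ n F i₀, hQ, eval_sub, eval_mul, eval_finsetSum, eval_secPoly,
      eval_sahiEP (secPoly p e) _ _ (fun h => eval_secPoly p e s h) (n + 1) G]
    congr 1
    exact sum_congr rfl fun l _ => eval_sahiEP (secPoly p e) _ _ (fun h => eval_secPoly p e s h) (n + 1) _
  have hQ0 : Q = 0 := by
    refine Polynomial.eq_zero_of_infinite_isRoot _ ((Set.Ioo_infinite (zero_lt_one' ℝ)).mono fun x hx => ?_)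
    have hx0 := hQeval ⟨x, hx.1.le, hx.2.le⟩
    rw [h _ hx] at hx0
    exact hx0
  -- its `s^{n+1}`-coefficient
  have hMf : secPoly p e (F i₀) = C (secEx p e (F i₀) false) := by
    rw [secPoly, hfree, sub_self, C_0, zero_mul, add_zero]
  have hA : (sahiEP (secPoly p e) (n + 1) G * secPoly p e (F i₀)).coeff (n + 1) =
      secEx p e (F i₀) false * ((-1) ^ n * ∏ j, (secEx p e (G j) true - secEx p e (G j) false)) := by
    rw [hMf, coeff_mul_C, coeff_sahiEP_top (secPoly p e) hM n G, mul_comm]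
    simp only [coeff_secPoly_one]
  have hB : ∀ l : Fin (n + 1), (sahiEP (secPoly p e) (n + 1) (update G l (G l * F i₀))).coeff (n + 1) =
      (-1) ^ n * ((secEx p e (G l * F i₀) true - secEx p e (G l * F i₀) false) *
        ∏ j ∈ univ.erase l, (secEx p e (G j) true - secEx p e (G j) false)) := by
    intro l
    rw [coeff_sahiEP_top (secPoly p e) hM n]
    congr 1
    have hupd : (fun j => (secPoly p e (update G l (G l * F i₀) j)).coeff 1) =
        update (fun j => (secPoly p e (G j)).coeff 1) l ((secPoly p e (G l * F i₀)).coeff 1) := by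
      funext j; exact apply_update (fun _ g => (secPoly p e g).coeff 1) G l (G l * F i₀) j
    rw [hupd, prod_update_of_mem (mem_univ l), sdiff_singleton_eq_erase]
    simp only [coeff_secPoly_one]
  have hcoeff : Q.coeff (n + 1) = (-1) ^ n *
      ((∑ l : Fin (n + 1), (secEx p e (G l * F i₀) true - secEx p e (G l * F i₀) false) *
          ∏ j ∈ univ.erase l, (secEx p e (G j) true - secEx p e (G j) false)) -
        secEx p e (F i₀) false * ∏ j, (secEx p e (G j) true - secEx p e (G j) false)) := by
    rw [hQ, coeff_sub, finsetSum_coeff, hA]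
    simp_rw [hB]
    rw [← mul_sum]
    ring
  rw [hQ0, coeff_zero] at hcoeff
  have h1 : ((-1 : ℝ) ^ n) ≠ 0 := pow_ne_zero _ (by norm_num)
  exact sub_eq_zero.1 ((mul_eq_zero.1 hcoeff.symm).resolve_left h1)

/-- **The detector for events**: `k = n+2` increasing events, `e` acting on none but possibly `U j`, `j ≠ i₀` — precisely, `U i₀` does not
depend on `e` — and `E_k ≡ 0` on the fibre `p[e ↦ ·]`.  Then, off `e` (section moments at `p`),
`Σ_{j ≠ i₀} P(U_{i₀} ∩ Piv_e U_j) · ∏_{l ∉ {j, i₀}} P(Piv_e U_l) = P(U_{i₀}) · ∏_{j ≠ i₀} P(Piv_e U_j)`, where `P(Piv_e U_j) = X₁(1_{U_j}) − X₀(1_{U_j})`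
and `P(U_{i₀} ∩ Piv_e U_j) = X₁(1_{U_j} 1_{U_{i₀}}) − X₀(1_{U_j} 1_{U_{i₀}})`.  When `e` is pivotal for every `U j`, `j ≠ i₀`, this is
prim-masterthm-p4's `Σ_j P(U_{i₀} | Piv_e U_j) ≡ P(U_{i₀})`. [this work] -/
theorem detector_ind_of_forall_sahiE_update_eq_zero (p : ι → unitInterval) (e : ι) {n : ℕ} (U : Fin (n + 2) → Set (Set ι))
    (hU : ∀ j, IsUpperSet (U j)) (i₀ : Fin (n + 2)) (he : ¬ Affects (U i₀) e)
    (h : ∀ s : unitInterval, (s : ℝ) ∈ Set.Ioo (0 : ℝ) 1 → sahiE (bernoulliWeight (update p e s)) (n + 2) (fun j => ind (U j)) = 0) :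
    (∑ l : Fin (n + 1), (secEx p e (ind (U (i₀.succAbove l)) * ind (U i₀)) true - secEx p e (ind (U (i₀.succAbove l)) * ind (U i₀)) false) *
        ∏ j ∈ univ.erase l, (secEx p e (ind (U (i₀.succAbove j))) true - secEx p e (ind (U (i₀.succAbove j))) false)) =
      secEx p e (ind (U i₀)) false *
        ∏ j, (secEx p e (ind (U (i₀.succAbove j))) true - secEx p e (ind (U (i₀.succAbove j))) false) :=
  detector_of_forall_sahiE_update_eq_zero p e (fun j => ind (U j)) i₀ (secEx_ind_true_eq_false (hU i₀) he p) h

end Bernoulli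

end Summit.CriticalPhenomena.PercolationContinuityZ3.Theorems
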